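import Summits.Ventures.YMGap.RobustBall.ZdPairwiseColumn
import Summits.Ventures.YMGap.RobustBall.MassGapOfDoorKR
import Summits.Ventures.YMGap.RobustBall.MassGapOnBallZdG
import Literature.MathematicalPhysics.QuantumFieldTheory.Balaban1983to89.StrongCouplingKernelWindow
import HarnessLib

/-!
# Robust ball (Y2) — `ℓ∞`-SEPARATION CLUSTERING AT THE AXIS RATE for every DLR state of every member of the tier-1 `ℤ^d` ball, the Wilson centre,
# and the `SU(2)` / `SU(N)` cells: `|cov_μ(f,g)| ≤ (4N/(θ(1−s))) (Σδ_g)(Σδ_f) θ^{2n}` at `ℓ∞`-distance `n`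

HONEST FRAMING: venture file of the cell `pub-ymgap` (QuantumFields programme), track ROBUST-BALL, seat rb-p2 (g11).  Strong-coupling LATTICE floor on
the decay of truncated correlations of DLR states of perturbed `SU(N)` Wilson specifications on `ℤ^d` (rb-p1's `perturbedYM`, ds-4's Kantorovich–Rubinstein
door `isKRContraction_perturbedYM_of_oneLinkKRModulus`, ds-2's typed gauge-invariant tier-1 ball `MemBallZdG`); the one-link modulus `OneLinkKRModulus N b K` is
a hypothesis by name (cells: the tree's quarter modulus for `SU(2)`, the Bakry–Émery modulus for every `N ≥ 2`); the uniqueness window of the tree is implied,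
not touched; the rate is a Dobrushin-comparison floor (an upper bound on the correlation length), not a computation of the mass gap; nothing continuum /
spectral / Clay.

CONTENT (the generic bound is `ZdPairwiseColumn.abs_cov_le_linfty_of_split`):
* `perturbedYM_abs_cov_le_linfty` — every DLR state of a member given by explicit load witnesses `(a, ℓ_s, Λ, R)` through the KR door
  (`A = K e^{a}(1+2√N ℓ_s)|β|`, `L = √N·ℓ(e,y)`): `K e^{a}(1+2√Nℓ_s)|β|·P(θ) + √NΛ θ⁻¹^{2R+1} ≤ s < 1 ⇒ |cov_μ(f,g)| ≤ (4N/(θ(1−s)))(Σδ_g)(Σδ_f) θ^{2n}`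
  for ALL bounded measurable local Lipschitz `f, g` with supports at `ℓ∞`-distance `≥ n`, `P(θ) = max(2(d−1)(θ+θ⁻¹+1), θ⁻²+2θ⁻¹+2θ+θ²+6(d−2))`;
* `memBallZdG_abs_cov_le_linfty` — the typed tier-1 ball `MemBallZdG ε₀ ε₁ R` (`a = ε₀`, `ℓ_s = Λ = ε₁` by site incidence);
* `ym_abs_cov_le_linfty` — the Wilson centre: `K|β|·P(θ) ≤ s < 1`, EVERY DLR state, ARBITRARY supports (the axis-separated shape of
  `ZdAxisClustering.ym_abs_cov_le_axis` is the special case of two half-spaces);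
* cells, `d = 4`: `SU(2)` Wilson `β_W = 1/8` (`θ = 3/10`, `s = 24/25`, constant `2000/3`, rate `2 log(10/3) = 2.41` per lattice unit in `ℓ∞`-separation —
  `su2_abs_cov_le_linfty_oneEighth`); the `SU(2)` ball `MemBallZdG (1/100) (1/500) 1` at `β_W = 1/8` (`θ = 1/3`, `s = 39/40`, constant `960`, rate `2 log 3 = 2.20` —
  `su2_memBallZdG_abs_cov_le_linfty_oneEighth`); ★★ the `SU(2)` LAW in closed form `θ = √β_W` on `0 < β_W ≤ 1/8`: constant `160/(3√β_W)`, rate `log(1/β_W)`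
  (`su2_abs_cov_le_linfty_law_dim4`), and `d = 3` on `0 < β_W ≤ 1/4`: constant `200/√β_W`, rate `log(1/β_W)` (`su2_abs_cov_le_linfty_law_dim3`); every `N ≥ 2`, closed form `θ = 2√κ`, `κ = b/(1/2 − 6b)`, `0 < b ≤ 1/64`, `s = 97/100` (`suN_abs_cov_le_linfty_dim4`).

References: H. Föllmer, LNM 1362 (1988), Ch. I, Thm. (2.13); H. Künsch, CMP 84 (1982) 207; Shen–Zhu–Zhu, CMP 400 (2023) §4 (one-link law, Bakry–Émery modulus);
the tree: `ZdPairwiseColumn` (this seat), `RobustMassGapDoorKR` / `MassGapOfDoorKR` (ds-4), `MassGapOnBallZdG` (ds-2), `SlabAreaLawDimensions`, `StrongCouplingKernelWindow`.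
-/

noncomputable section

open MeasureTheory ProbabilityTheory Filter Topology Function Finset Real
open scoped NNReal
open Literature.Probability.LatticeModels
open Literature.Probability.LatticeModels.DobrushinMetric
open Literature.MathematicalPhysics.QuantumLattice
open Literature.MathematicalPhysics.QuantumFieldTheory hiding ZdEdge
open Literature.MathematicalPhysics.QuantumFieldTheory.Balaban1983to89.StrongCouplingDobrushinWindow (OneLinkKRModulus)

namespace Summit.Ventures.YMGap.RobustBall.ZdAxis

variable {d N : ℕ}

/-! ### Members of the tier-1 `ℤ^d` ball through the Kantorovich–Rubinstein door -/

/-- **`ℓ∞`-CLUSTERING AT THE AXIS RATE, UNIFORM IN THE TIER-1 LOADS (KR door).**  `d ≥ 2`, `N ≥ 1`, 't Hooft `β`, `OneLinkKRModulus N b K` on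
`b ≥ 2(d−1)|β|`; a member: a link potential `W` (adapted, termwise bounded, supported by `supp`) with oscillation load `≤ a`, self-Lipschitz load `≤ ℓ_s`,
cross-Lipschitz load `≤ Λ`, range `‖e − y‖∞ ≤ R` on the listed sets through `e` (`R ≥ 1`); `A = K e^{a}(1 + 2√N ℓ_s)|β|`.  If `0 < θ ≤ 1`, `s < 1` and
`A·max(2(d−1)(θ+θ⁻¹+1), θ⁻²+2θ⁻¹+2θ+θ²+6(d−2)) + √NΛ θ⁻¹^{2R+1} ≤ s`, then EVERY DLR state of the member and ALL bounded measurable local Lipschitz `f, g`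
with supports at `ℓ∞`-distance `≥ n` satisfy `|cov_μ(f,g)| ≤ (4N/(θ(1−s)))(Σδ_g)(Σδ_f) θ^{2n}`. [folklore] -/
theorem perturbedYM_abs_cov_le_linfty (hd : 2 ≤ d) (hN : 1 ≤ N) {β b K a ℓs Λ : ℝ} (hK : 0 ≤ K) (hℓs : 0 ≤ ℓs)
    (hb : |β| * (2 * ((d : ℝ) - 1)) ≤ b) (hmod : OneLinkKRModulus N b K)
    {W : Potential (ZdEdge d) (Matrix.specialUnitaryGroup (Fin N) ℂ)} (hW : W.IsAdapted) (hWb : ∀ X, ∃ C, ∀ U, |W X U| ≤ C)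
    {supp : Finset (ZdEdge d) → Finset (Finset (ZdEdge d))} (hsupp : W.IsSupportedBy supp)
    {osc : Finset (ZdEdge d) → ZdEdge d → ℝ} (hosc : ∀ X, Dobrushin.IsOscBound (W X) (osc X))
    (hosca : ∀ e, ∑ X ∈ (supp {e}).filter (fun X => e ∈ X), osc X e ≤ a)
    {lip : Finset (ZdEdge d) → ZdEdge d → ℝ} (hlip : ∀ X, IsLipBound suFrobDist (W X) (lip X))
    (hlips : ∀ e, ∑ X ∈ (supp {e}).filter (fun X => e ∈ X), lip X e ≤ ℓs)
    (hΛ : ∀ e, ∑ y ∈ perturbedNbr supp e, ∑ X ∈ (supp {e}).filter (fun X => e ∈ X), lip X y ≤ Λ)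
    {R : ℕ} (hR1 : 1 ≤ R) (hR : ∀ e, ∀ X ∈ supp {e}, e ∈ X → ∀ y ∈ X, ‖e.1 - y.1‖ ≤ (R : ℝ))
    {θ s : ℝ} (hθ0 : 0 < θ) (hθ1 : θ ≤ 1) (hs1 : s < 1)
    (hsup : K * exp a * (1 + 2 * Real.sqrt N * ℓs) * |β| *
        max (2 * ((d : ℝ) - 1) * (θ + θ⁻¹ + 1)) (θ⁻¹ ^ 2 + 2 * θ⁻¹ + 2 * θ + θ ^ 2 + 6 * ((d : ℝ) - 2)) +
      Real.sqrt N * Λ * θ⁻¹ ^ (2 * R + 1) ≤ s)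
    {μ : Measure (LGConfig d (Matrix.specialUnitaryGroup (Fin N) ℂ))}
    (hμ : μ ∈ perturbedGibbsMeasures (d := d) (fundamentalRep (Fin N)) (N * β) W supp)
    {f g : LGConfig d (Matrix.specialUnitaryGroup (Fin N) ℂ) → ℝ} (hfm : Measurable f) {Δf : Finset (ZdEdge d)}
    (hfdep : DependsOn f (↑Δf : Set (ZdEdge d))) {Mf : ℝ} (hMf : ∀ σ, |f σ| ≤ Mf) {δf : ZdEdge d → ℝ}
    (hδf : IsLipBound suFrobDist f δf) (hgm : Measurable g) {Δg : Finset (ZdEdge d)}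
    (hgdep : DependsOn g (↑Δg : Set (ZdEdge d))) {Mg : ℝ} (hMg : ∀ σ, |g σ| ≤ Mg) {δg : ZdEdge d → ℝ}
    (hδg : IsLipBound suFrobDist g δg) (n : ℕ) (hdist : ∀ x ∈ Δf, ∀ y ∈ Δg, (n : ℝ) ≤ ‖x.1 - y.1‖) :
    |cov[f, g; μ]| ≤ 4 * N / (θ * (1 - s)) * (∑ y ∈ Δg, δg y) * (∑ x ∈ Δf, δf x) * θ ^ (2 * n) := by
  classical
  haveI : SecondCountableTopology (Matrix (Fin N) (Fin N) ℂ) :=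
    inferInstanceAs (SecondCountableTopology (Fin N → Fin N → ℂ))
  haveI : SecondCountableTopology (Matrix.specialUnitaryGroup (Fin N) ℂ) :=
    Topology.IsEmbedding.subtypeVal.secondCountableTopology
  have hd1 : 1 ≤ d := by omega
  have hγ : IsSpecification (perturbedYM (d := d) (fundamentalRep (Fin N)) (N * β) W supp) :=
    isSpecification_perturbedYM _ (continuous_fundamentalRep (Fin N)) _ hW hWb hsupp
  have hKR := isKRContraction_perturbedYM_of_oneLinkKRModulus hd1 hN hK hℓs hb hmod hW (supp := supp) hosc hosca hlip hlips
  have hμ' : IsGibbsMeasure (perturbedYM (d := d) (fundamentalRep (Fin N)) (N * β) W supp) μ := hμ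
  set A : ℝ := K * exp a * (1 + 2 * Real.sqrt N * ℓs) * |β| with hA
  have hA0 : 0 ≤ A := by positivity
  refine abs_cov_le_linfty_of_split hd hγ hKR hA0
    (L := fun e y => Real.sqrt N * ∑ X ∈ (supp {e}).filter (fun X => e ∈ X), lip X y)
    (fun e y => mul_nonneg (Real.sqrt_nonneg _) (Finset.sum_nonneg fun X _ => (hlip X).nonneg y))
    (fun e y _ => by rw [hA]) (Λ := Real.sqrt N * Λ)
    (fun e => by rw [← Finset.mul_sum]; exact mul_le_mul_of_nonneg_left (hΛ e) (Real.sqrt_nonneg _))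
    (R := R) (fun e y hy => ?_) hθ0 hθ1 hs1 (by rw [hA]; exact hsup)
    hμ' hfm hfdep hMf hδf hgm hgdep hMg hδg n hdist
  -- the range of the neighbourhoods: plaquette neighbours at distance `≤ 1`, listed sets at distance `≤ R`
  rcases (mem_perturbedNbr_iff.1 hy).2 with hy' | ⟨X, hX, hxX, hyX⟩
  · exact (norm_sub_le_one_of_mem_linkPlaqNbr hy').trans (by exact_mod_cast hR1)
  · exact hR e X hX hxX y hyX

/-- **THE TYPED TIER-1 BALL: `ℓ∞`-clustering at the axis rate for every DLR state of every member of `MemBallZdG ε₀ ε₁ R`** (ds-2's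
gauge-invariant tier-1 `ℤ^d` ball; loads `a = ε₀`, `ℓ_s = Λ = ε₁` by site incidence; `R ≥ 1`).  Condition:
`K e^{ε₀}(1 + 2√N ε₁)|β|·max(2(d−1)(θ+θ⁻¹+1), θ⁻²+2θ⁻¹+2θ+θ²+6(d−2)) + √N ε₁ θ⁻¹^{2R+1} ≤ s < 1`. [folklore] -/
theorem memBallZdG_abs_cov_le_linfty (hd : 2 ≤ d) (hN : 1 ≤ N) {β b K ε₀ ε₁ : ℝ} {R : ℕ} (hK : 0 ≤ K) (hR1 : 1 ≤ R)
    (hb : |β| * (2 * ((d : ℝ) - 1)) ≤ b) (hmod : OneLinkKRModulus N b K)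
    {W : Potential (ZdEdge d) (Matrix.specialUnitaryGroup (Fin N) ℂ)} {supp : Finset (ZdEdge d) → Finset (Finset (ZdEdge d))}
    (hmem : MemBallZdG ε₀ ε₁ R W supp) {θ s : ℝ} (hθ0 : 0 < θ) (hθ1 : θ ≤ 1) (hs1 : s < 1)
    (hsup : K * exp ε₀ * (1 + 2 * Real.sqrt N * ε₁) * |β| *
        max (2 * ((d : ℝ) - 1) * (θ + θ⁻¹ + 1)) (θ⁻¹ ^ 2 + 2 * θ⁻¹ + 2 * θ + θ ^ 2 + 6 * ((d : ℝ) - 2)) +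
      Real.sqrt N * ε₁ * θ⁻¹ ^ (2 * R + 1) ≤ s)
    {μ : Measure (LGConfig d (Matrix.specialUnitaryGroup (Fin N) ℂ))}
    (hμ : μ ∈ perturbedGibbsMeasures (d := d) (fundamentalRep (Fin N)) (N * β) W supp)
    {f g : LGConfig d (Matrix.specialUnitaryGroup (Fin N) ℂ) → ℝ} (hfm : Measurable f) {Δf : Finset (ZdEdge d)}
    (hfdep : DependsOn f (↑Δf : Set (ZdEdge d))) {Mf : ℝ} (hMf : ∀ σ, |f σ| ≤ Mf) {δf : ZdEdge d → ℝ}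
    (hδf : IsLipBound suFrobDist f δf) (hgm : Measurable g) {Δg : Finset (ZdEdge d)}
    (hgdep : DependsOn g (↑Δg : Set (ZdEdge d))) {Mg : ℝ} (hMg : ∀ σ, |g σ| ≤ Mg) {δg : ZdEdge d → ℝ}
    (hδg : IsLipBound suFrobDist g δg) (n : ℕ) (hdist : ∀ x ∈ Δf, ∀ y ∈ Δg, (n : ℝ) ≤ ‖x.1 - y.1‖) :
    |cov[f, g; μ]| ≤ 4 * N / (θ * (1 - s)) * (∑ y ∈ Δg, δg y) * (∑ x ∈ Δf, δf x) * θ ^ (2 * n) := by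
  classical
  obtain ⟨osc, lip, hosc, hlip, hε₀, hε₁⟩ := hmem.loads
  have hW : W.IsAdapted := fun X => ⟨hmem.dependsOn X, (hmem.continuous X).measurable⟩
  have hWb : ∀ X, ∃ C, ∀ U, |W X U| ≤ C := fun X => exists_bound_of_continuous (hmem.continuous X)
  -- restricted Lipschitz witnesses and the site-incidence loads
  set lip' : Finset (ZdEdge d) → ZdEdge d → ℝ := fun X y => if y ∈ X then lip X y else 0 with hlip'
  have hlipr : ∀ X, IsLipBound suFrobDist (W X) (lip' X) := fun X => (hlip X).restrict (hmem.dependsOn X)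
  have hε₁0 : 0 ≤ ε₁ := by
    have hd0 : 0 < d := by omega
    refine le_trans (Finset.sum_nonneg fun X _ => Finset.sum_nonneg fun y _ => (hlip X).nonneg y) (hε₁ (fun _ => 0))
  have hlips : ∀ e, ∑ X ∈ (supp {e}).filter (fun X => e ∈ X), lip' X e ≤ ε₁ := by
    intro e
    calc ∑ X ∈ (supp {e}).filter (fun X => e ∈ X), lip' X e ≤ ∑ X ∈ (supp {e}).filter (fun X => e ∈ X), ∑ y ∈ X, lip X y := by
          refine Finset.sum_le_sum fun X hX => ?_
          have heX : e ∈ X := (Finset.mem_filter.1 hX).2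
          simp only [hlip', if_pos heX]
          exact Finset.single_le_sum (fun y _ => (hlip X).nonneg y) heX
      _ ≤ ∑ X ∈ listedAt supp e.1, ∑ y ∈ X, lip X y :=
          Finset.sum_le_sum_of_subset_of_nonneg (filter_supp_subset_listedAt supp e)
            fun X _ _ => Finset.sum_nonneg fun y _ => (hlip X).nonneg y
      _ ≤ ε₁ := hε₁ e.1
  have hΛ : ∀ e, ∑ y ∈ perturbedNbr supp e, ∑ X ∈ (supp {e}).filter (fun X => e ∈ X), lip' X y ≤ ε₁ := by
    intro e
    rw [Finset.sum_comm]
    calc ∑ X ∈ (supp {e}).filter (fun X => e ∈ X), ∑ y ∈ perturbedNbr supp e, lip' X y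
        ≤ ∑ X ∈ (supp {e}).filter (fun X => e ∈ X), ∑ y ∈ X, lip X y := by
          refine Finset.sum_le_sum fun X _ => ?_
          simp only [hlip']
          rw [← Finset.sum_filter]
          exact Finset.sum_le_sum_of_subset_of_nonneg (fun y hy => (Finset.mem_filter.1 hy).2) fun y _ _ => (hlip X).nonneg y
      _ ≤ ∑ X ∈ listedAt supp e.1, ∑ y ∈ X, lip X y :=
          Finset.sum_le_sum_of_subset_of_nonneg (filter_supp_subset_listedAt supp e)
            fun X _ _ => Finset.sum_nonneg fun y _ => (hlip X).nonneg y
      _ ≤ ε₁ := hε₁ e.1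
  exact perturbedYM_abs_cov_le_linfty hd hN hK hε₁0 hb hmod hW hWb hmem.supportedBy hosc hε₀ hlipr hlips hΛ hR1 hmem.range
    hθ0 hθ1 hs1 hsup hμ hfm hfdep hMf hδf hgm hgdep hMg hδg n hdist

/-- **THE WILSON CENTRE: `ℓ∞`-clustering at the axis rate for EVERY DLR state of `SU(N)` lattice Yang–Mills on `ℤ^d`** (`d ≥ 2`, `N ≥ 1`, 't Hooft `β`,
modulus `OneLinkKRModulus N b K` on `b ≥ 2(d−1)|β|`): if `K|β|·max(2(d−1)(θ+θ⁻¹+1), θ⁻²+2θ⁻¹+2θ+θ²+6(d−2)) ≤ s < 1` then for all bounded measurable local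
Lipschitz `f, g` with supports at `ℓ∞`-distance `≥ n`, `|cov_μ(f,g)| ≤ (4N/(θ(1−s)))(Σδ_g)(Σδ_f) θ^{2n}` — ARBITRARY supports (the axis-separated
shape of `ZdAxisClustering.ym_abs_cov_le_axis` is the special case of one pair of half-spaces). [folklore] -/
theorem ym_abs_cov_le_linfty (hd : 2 ≤ d) (hN : 1 ≤ N) {β b K : ℝ} (hK : 0 ≤ K) (hb : |β| * (2 * ((d : ℝ) - 1)) ≤ b)
    (hmod : OneLinkKRModulus N b K) {θ s : ℝ} (hθ0 : 0 < θ) (hθ1 : θ ≤ 1) (hs1 : s < 1)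
    (hsup : K * |β| * max (2 * ((d : ℝ) - 1) * (θ + θ⁻¹ + 1)) (θ⁻¹ ^ 2 + 2 * θ⁻¹ + 2 * θ + θ ^ 2 + 6 * ((d : ℝ) - 2)) ≤ s)
    {μ : Measure (LGConfig d (Matrix.specialUnitaryGroup (Fin N) ℂ))}
    (hμ : μ ∈ ymGibbsMeasures (d := d) (fundamentalRep (Fin N)) (N * β))
    {f g : LGConfig d (Matrix.specialUnitaryGroup (Fin N) ℂ) → ℝ} (hfm : Measurable f) {Δf : Finset (ZdEdge d)}
    (hfdep : DependsOn f (↑Δf : Set (ZdEdge d))) {Mf : ℝ} (hMf : ∀ σ, |f σ| ≤ Mf) {δf : ZdEdge d → ℝ}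
    (hδf : IsLipBound suFrobDist f δf) (hgm : Measurable g) {Δg : Finset (ZdEdge d)}
    (hgdep : DependsOn g (↑Δg : Set (ZdEdge d))) {Mg : ℝ} (hMg : ∀ σ, |g σ| ≤ Mg) {δg : ZdEdge d → ℝ}
    (hδg : IsLipBound suFrobDist g δg) (n : ℕ) (hdist : ∀ x ∈ Δf, ∀ y ∈ Δg, (n : ℝ) ≤ ‖x.1 - y.1‖) :
    |cov[f, g; μ]| ≤ 4 * N / (θ * (1 - s)) * (∑ y ∈ Δg, δg y) * (∑ x ∈ Δf, δf x) * θ ^ (2 * n) := by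
  have hmem := memBallZdG_zero (d := d) (N := N) (ε₀ := 0) (ε₁ := 0) le_rfl le_rfl 1
  have hμ' : μ ∈ perturbedGibbsMeasures (d := d) (fundamentalRep (Fin N)) (N * β) 0 (fun _ => (∅ : Finset (Finset (ZdEdge d)))) := by
    rw [perturbedGibbsMeasures_zero]; exact hμ
  refine memBallZdG_abs_cov_le_linfty hd hN hK le_rfl hb hmod hmem hθ0 hθ1 hs1 ?_ hμ' hfm hfdep hMf hδf hgm hgdep hMg hδg n hdist
  simpa using hsup

/-! ### Cells: `SU(2)`, `d = 4` (quarter modulus) and every `N ≥ 2` (Bakry–Émery modulus) -/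

/-- ★ **`SU(2)`, `d = 4`, Wilson, `β_W = 1/8` (tree coupling `1/16`, 't Hooft `1/32`; quarter modulus `K = 1` on radius `3/16`): `θ = 3/10`, `s = 24/25`** —
for EVERY DLR state and ALL bounded measurable local Lipschitz `f, g` with supports at `ℓ∞`-distance `≥ n`:
`|cov_μ(f,g)| ≤ (2000/3)(Σδ_g)(Σδ_f)(3/10)^{2n}`, rate `2 log(10/3) = 2.41` per lattice unit.  Check: `(1/32)·max(6·(0.3+10/3+1), 100/9+20/3+0.6+0.09+12)
= (1/32)·30.47 = 0.952 ≤ 0.96`. [folklore] -/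
theorem su2_abs_cov_le_linfty_oneEighth {μ : Measure (LGConfig 4 (Matrix.specialUnitaryGroup (Fin 2) ℂ))}
    (hμ : μ ∈ ymGibbsMeasures (d := 4) (fundamentalRep (Fin 2)) (2 * (1 / 32)))
    {f g : LGConfig 4 (Matrix.specialUnitaryGroup (Fin 2) ℂ) → ℝ} (hfm : Measurable f) {Δf : Finset (ZdEdge 4)}
    (hfdep : DependsOn f (↑Δf : Set (ZdEdge 4))) {Mf : ℝ} (hMf : ∀ σ, |f σ| ≤ Mf) {δf : ZdEdge 4 → ℝ}
    (hδf : IsLipBound suFrobDist f δf) (hgm : Measurable g) {Δg : Finset (ZdEdge 4)}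
    (hgdep : DependsOn g (↑Δg : Set (ZdEdge 4))) {Mg : ℝ} (hMg : ∀ σ, |g σ| ≤ Mg) {δg : ZdEdge 4 → ℝ}
    (hδg : IsLipBound suFrobDist g δg) (n : ℕ) (hdist : ∀ x ∈ Δf, ∀ y ∈ Δg, (n : ℝ) ≤ ‖x.1 - y.1‖) :
    |cov[f, g; μ]| ≤ 2000 / 3 * (∑ y ∈ Δg, δg y) * (∑ x ∈ Δf, δf x) * (3 / 10 : ℝ) ^ (2 * n) := by
  have hmod := SlabAreaLawDimensions.su2_oneLinkKRModulus_of_le_one (R := 3 / 16) (by norm_num)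
  have habs : |(1 / 32 : ℝ)| = 1 / 32 := abs_of_pos (by norm_num)
  have h := ym_abs_cov_le_linfty (d := 4) (N := 2) (by norm_num) (by norm_num) (β := 1 / 32) zero_le_one
    (by rw [habs]; norm_num) hmod (θ := 3 / 10) (s := 24 / 25) (by norm_num) (by norm_num) (by norm_num)
    (by rw [habs]; norm_num) hμ hfm hfdep hMf hδf hgm hgdep hMg hδg n hdist
  have e : (4 * ((2 : ℕ) : ℝ) / ((3 / 10 : ℝ) * (1 - 24 / 25))) = 2000 / 3 := by norm_num
  rw [e] at h
  exact h

/-- ★ **`SU(2)`, `d = 4`, the BALL `MemBallZdG (1/100) (1/500) 1` at `β_W = 1/8`** (tree coupling `1/16`, 't Hooft `1/32`; quarter modulus): `θ = 1/3`,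
`s = 39/40` — for EVERY member `(W, supp)`, EVERY DLR state of the member and ALL bounded measurable local Lipschitz `f, g` with supports at `ℓ∞`-distance
`≥ n`: `|cov_μ(f,g)| ≤ 960 (Σδ_g)(Σδ_f)(1/3)^{2n}`, rate `2 log 3 = 2.20` per lattice unit.  Check: `e^{1/100}(1+2√2/500)(1/32)(250/9) + √2·27/500 ≤
1.02·1.006·0.8681 + 0.081 = 0.972 ≤ 0.975`. [folklore] -/
theorem su2_memBallZdG_abs_cov_le_linfty_oneEighth {W : Potential (ZdEdge 4) (Matrix.specialUnitaryGroup (Fin 2) ℂ)}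
    {supp : Finset (ZdEdge 4) → Finset (Finset (ZdEdge 4))} (hmem : MemBallZdG (1 / 100) (1 / 500) 1 W supp)
    {μ : Measure (LGConfig 4 (Matrix.specialUnitaryGroup (Fin 2) ℂ))}
    (hμ : μ ∈ perturbedGibbsMeasures (d := 4) (fundamentalRep (Fin 2)) (2 * (1 / 32)) W supp)
    {f g : LGConfig 4 (Matrix.specialUnitaryGroup (Fin 2) ℂ) → ℝ} (hfm : Measurable f) {Δf : Finset (ZdEdge 4)}
    (hfdep : DependsOn f (↑Δf : Set (ZdEdge 4))) {Mf : ℝ} (hMf : ∀ σ, |f σ| ≤ Mf) {δf : ZdEdge 4 → ℝ}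
    (hδf : IsLipBound suFrobDist f δf) (hgm : Measurable g) {Δg : Finset (ZdEdge 4)}
    (hgdep : DependsOn g (↑Δg : Set (ZdEdge 4))) {Mg : ℝ} (hMg : ∀ σ, |g σ| ≤ Mg) {δg : ZdEdge 4 → ℝ}
    (hδg : IsLipBound suFrobDist g δg) (n : ℕ) (hdist : ∀ x ∈ Δf, ∀ y ∈ Δg, (n : ℝ) ≤ ‖x.1 - y.1‖) :
    |cov[f, g; μ]| ≤ 960 * (∑ y ∈ Δg, δg y) * (∑ x ∈ Δf, δf x) * (1 / 3 : ℝ) ^ (2 * n) := by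
  have hmod := SlabAreaLawDimensions.su2_oneLinkKRModulus_of_le_one (R := 3 / 16) (by norm_num)
  have habs : |(1 / 32 : ℝ)| = 1 / 32 := abs_of_pos (by norm_num)
  have hexp : Real.exp (1 / 100 : ℝ) ≤ 51 / 50 := by
    have h := Real.exp_bound_div_one_sub_of_interval' (x := 1 / 100) (by norm_num) (by norm_num)
    have : (1 : ℝ) / (1 - 1 / 100) ≤ 51 / 50 := by norm_num
    linarith
  have hsqrt : Real.sqrt 2 ≤ 3 / 2 := by
    rw [show (3 / 2 : ℝ) = Real.sqrt ((3 / 2) ^ 2) by rw [Real.sqrt_sq (by norm_num)]]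
    exact Real.sqrt_le_sqrt (by norm_num)
  have h := memBallZdG_abs_cov_le_linfty (d := 4) (N := 2) (by norm_num) (by norm_num) (β := 1 / 32) (ε₀ := 1 / 100) (ε₁ := 1 / 500)
    (R := 1) (θ := 1 / 3) (s := 39 / 40) zero_le_one le_rfl (by rw [habs]; norm_num) hmod hmem (by norm_num) (by norm_num) (by norm_num) ?_
    hμ hfm hfdep hMf hδf hgm hgdep hMg hδg n hdist
  · have e : (4 * ((2 : ℕ) : ℝ) / ((1 / 3 : ℝ) * (1 - 39 / 40))) = 960 := by norm_num
    rw [e] at h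
    exact h
  · rw [habs]
    have hmax : max (2 * (((4 : ℕ) : ℝ) - 1) * ((1 / 3 : ℝ) + (1 / 3)⁻¹ + 1))
        ((1 / 3 : ℝ)⁻¹ ^ 2 + 2 * (1 / 3 : ℝ)⁻¹ + 2 * (1 / 3) + (1 / 3) ^ 2 + 6 * (((4 : ℕ) : ℝ) - 2)) = 250 / 9 := by norm_num
    have hm1 : (2 * 1 + 1 : ℕ) = 3 := by norm_num
    rw [hmax, hm1]
    have hcast : Real.sqrt ((2 : ℕ) : ℝ) = Real.sqrt 2 := by norm_num
    rw [hcast]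
    have h3 : Real.exp (1 / 100) * (1 + 2 * Real.sqrt 2 * (1 / 500)) ≤ 51 / 50 * (1 + 2 * (3 / 2) * (1 / 500)) :=
      mul_le_mul hexp (by linarith) (by positivity) (by norm_num)
    have h5 : 0 ≤ Real.sqrt 2 := Real.sqrt_nonneg _
    nlinarith [h3, hsqrt, h5, Real.exp_pos (1 / 100 : ℝ)]

/-- ★★ **THE `ℓ∞`-CLUSTERING LAW, `SU(2)`, `d = 4`, CLOSED FORM `θ = √β_W`**: for every `0 < β_W ≤ 1/8` (tree coupling `β_W/2`, 't Hooft `β_W/4`; quarter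
modulus `K = 1`), EVERY DLR state of the `SU(2)` Wilson specification on `ℤ⁴` and ALL bounded measurable local Lipschitz `f, g` with supports at `ℓ∞`-distance `≥ n`
satisfy `|cov_μ(f,g)| ≤ (160/(3√β_W)) (Σδ_g)(Σδ_f) β_W^{n}` — rate `log(1/β_W)` per lattice unit for ARBITRARY supports (margin `s = 17/20`; check at `t = √β_W ≤ 9/25`:
`(3/2)(t + t² + t³) ≤ 0.81`, `1/4 + t/2 + 3t² + t³/2 + t⁴/4 ≤ 0.85`). [folklore] -/
theorem su2_abs_cov_le_linfty_law_dim4 {βW : ℝ} (hβ0 : 0 < βW) (hβ : βW ≤ 1 / 8)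
    {μ : Measure (LGConfig 4 (Matrix.specialUnitaryGroup (Fin 2) ℂ))}
    (hμ : μ ∈ ymGibbsMeasures (d := 4) (fundamentalRep (Fin 2)) (2 * (βW / 4)))
    {f g : LGConfig 4 (Matrix.specialUnitaryGroup (Fin 2) ℂ) → ℝ} (hfm : Measurable f) {Δf : Finset (ZdEdge 4)}
    (hfdep : DependsOn f (↑Δf : Set (ZdEdge 4))) {Mf : ℝ} (hMf : ∀ σ, |f σ| ≤ Mf) {δf : ZdEdge 4 → ℝ}
    (hδf : IsLipBound suFrobDist f δf) (hgm : Measurable g) {Δg : Finset (ZdEdge 4)}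
    (hgdep : DependsOn g (↑Δg : Set (ZdEdge 4))) {Mg : ℝ} (hMg : ∀ σ, |g σ| ≤ Mg) {δg : ZdEdge 4 → ℝ}
    (hδg : IsLipBound suFrobDist g δg) (n : ℕ) (hdist : ∀ x ∈ Δf, ∀ y ∈ Δg, (n : ℝ) ≤ ‖x.1 - y.1‖) :
    |cov[f, g; μ]| ≤ 160 / (3 * Real.sqrt βW) * (∑ y ∈ Δg, δg y) * (∑ x ∈ Δf, δf x) * βW ^ n := by
  have habs : |βW / 4| = βW / 4 := abs_of_pos (by positivity)
  have hrad : |βW / 4| * (2 * (((4 : ℕ) : ℝ) - 1)) ≤ 1 := by rw [habs]; push_cast; nlinarith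
  have hmod := SlabAreaLawDimensions.su2_oneLinkKRModulus_of_le_one hrad
  set t : ℝ := Real.sqrt βW with ht
  have ht0 : 0 < t := Real.sqrt_pos.2 hβ0
  have ht2 : t ^ 2 = βW := Real.sq_sqrt hβ0.le
  have ht1 : t ≤ 9 / 25 := by nlinarith [ht2, ht0]
  have htne : t ≠ 0 := ht0.ne'
  have hθ1 : t ≤ 1 := by linarith
  have hsup : 1 * |βW / 4| *
      max (2 * (((4 : ℕ) : ℝ) - 1) * (t + t⁻¹ + 1)) (t⁻¹ ^ 2 + 2 * t⁻¹ + 2 * t + t ^ 2 + 6 * (((4 : ℕ) : ℝ) - 2)) ≤ 17 / 20 := by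
    rw [habs, ← ht2]
    have hpar : t ^ 2 / 4 * (2 * (((4 : ℕ) : ℝ) - 1) * (t + t⁻¹ + 1)) ≤ 17 / 20 := by
      have e : t ^ 2 / 4 * (2 * (((4 : ℕ) : ℝ) - 1) * (t + t⁻¹ + 1)) = 3 / 2 * (t ^ 3 + t + t ^ 2) := by
        push_cast; field_simp; ring
      rw [e]; nlinarith [pow_pos ht0 3, pow_le_pow_left₀ ht0.le ht1 2, pow_le_pow_left₀ ht0.le ht1 3]
    have hperp : t ^ 2 / 4 * (t⁻¹ ^ 2 + 2 * t⁻¹ + 2 * t + t ^ 2 + 6 * (((4 : ℕ) : ℝ) - 2)) ≤ 17 / 20 := by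
      have e : t ^ 2 / 4 * (t⁻¹ ^ 2 + 2 * t⁻¹ + 2 * t + t ^ 2 + 6 * (((4 : ℕ) : ℝ) - 2)) =
          1 / 4 + t / 2 + t ^ 3 / 2 + t ^ 4 / 4 + 3 * t ^ 2 := by
        push_cast; field_simp; ring
      rw [e]
      nlinarith [pow_pos ht0 3, pow_pos ht0 4, pow_le_pow_left₀ ht0.le ht1 2, pow_le_pow_left₀ ht0.le ht1 3,
        pow_le_pow_left₀ ht0.le ht1 4]
    rw [one_mul]
    rcases le_total (2 * (((4 : ℕ) : ℝ) - 1) * (t + t⁻¹ + 1)) (t⁻¹ ^ 2 + 2 * t⁻¹ + 2 * t + t ^ 2 + 6 * (((4 : ℕ) : ℝ) - 2)) with hle | hle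
    · rw [max_eq_right hle]; exact hperp
    · rw [max_eq_left hle]; exact hpar
  have h := ym_abs_cov_le_linfty (d := 4) (N := 2) (by norm_num) (by norm_num) (β := βW / 4) (K := 1) zero_le_one le_rfl hmod
    ht0 hθ1 (s := 17 / 20) (by norm_num) hsup (μ := μ) (by
      have e : ((2 : ℕ) : ℝ) * (βW / 4) = 2 * (βW / 4) := by norm_num
      rw [e]; exact hμ) hfm hfdep hMf hδf hgm hgdep hMg hδg n hdist
  have e1 : (4 * ((2 : ℕ) : ℝ) / (t * (1 - 17 / 20))) = 160 / (3 * t) := by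
    field_simp; ring
  have e2 : t ^ (2 * n) = βW ^ n := by rw [pow_mul, ht2]
  rw [e1, e2] at h
  exact h

/-- ★★ **THE `ℓ∞`-CLUSTERING LAW, `SU(2)`, `d = 3`, CLOSED FORM `θ = √β_W`**: for every `0 < β_W ≤ 1/4` (tree coupling `β_W/2`; quarter modulus on radius
`β_W ≤ 1`), EVERY DLR state of the `SU(2)` Wilson specification on `ℤ³` and ALL bounded measurable local Lipschitz `f, g` with supports at `ℓ∞`-distance `≥ n` satisfy
`|cov_μ(f,g)| ≤ (200/√β_W) (Σδ_g)(Σδ_f) β_W^{n}` — rate `log(1/β_W)` per lattice unit (margin `s = 24/25`; check at `t = √β_W ≤ 1/2`: `t + t² + t³ ≤ 0.875`,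
`1/4 + t/2 + 3t²/2 + t³/2 + t⁴/4 ≤ 0.954`). [folklore] -/
theorem su2_abs_cov_le_linfty_law_dim3 {βW : ℝ} (hβ0 : 0 < βW) (hβ : βW ≤ 1 / 4)
    {μ : Measure (LGConfig 3 (Matrix.specialUnitaryGroup (Fin 2) ℂ))}
    (hμ : μ ∈ ymGibbsMeasures (d := 3) (fundamentalRep (Fin 2)) (2 * (βW / 4)))
    {f g : LGConfig 3 (Matrix.specialUnitaryGroup (Fin 2) ℂ) → ℝ} (hfm : Measurable f) {Δf : Finset (ZdEdge 3)}
    (hfdep : DependsOn f (↑Δf : Set (ZdEdge 3))) {Mf : ℝ} (hMf : ∀ σ, |f σ| ≤ Mf) {δf : ZdEdge 3 → ℝ}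
    (hδf : IsLipBound suFrobDist f δf) (hgm : Measurable g) {Δg : Finset (ZdEdge 3)}
    (hgdep : DependsOn g (↑Δg : Set (ZdEdge 3))) {Mg : ℝ} (hMg : ∀ σ, |g σ| ≤ Mg) {δg : ZdEdge 3 → ℝ}
    (hδg : IsLipBound suFrobDist g δg) (n : ℕ) (hdist : ∀ x ∈ Δf, ∀ y ∈ Δg, (n : ℝ) ≤ ‖x.1 - y.1‖) :
    |cov[f, g; μ]| ≤ 200 / Real.sqrt βW * (∑ y ∈ Δg, δg y) * (∑ x ∈ Δf, δf x) * βW ^ n := by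
  have habs : |βW / 4| = βW / 4 := abs_of_pos (by positivity)
  have hrad : |βW / 4| * (2 * (((3 : ℕ) : ℝ) - 1)) ≤ 1 := by rw [habs]; push_cast; nlinarith
  have hmod := SlabAreaLawDimensions.su2_oneLinkKRModulus_of_le_one hrad
  set t : ℝ := Real.sqrt βW with ht
  have ht0 : 0 < t := Real.sqrt_pos.2 hβ0
  have ht2 : t ^ 2 = βW := Real.sq_sqrt hβ0.le
  have ht1 : t ≤ 1 / 2 := by nlinarith [ht2, ht0]
  have htne : t ≠ 0 := ht0.ne'
  have hθ1 : t ≤ 1 := by linarith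
  have hsup : 1 * |βW / 4| *
      max (2 * (((3 : ℕ) : ℝ) - 1) * (t + t⁻¹ + 1)) (t⁻¹ ^ 2 + 2 * t⁻¹ + 2 * t + t ^ 2 + 6 * (((3 : ℕ) : ℝ) - 2)) ≤ 24 / 25 := by
    rw [habs, ← ht2]
    have hpar : t ^ 2 / 4 * (2 * (((3 : ℕ) : ℝ) - 1) * (t + t⁻¹ + 1)) ≤ 24 / 25 := by
      have e : t ^ 2 / 4 * (2 * (((3 : ℕ) : ℝ) - 1) * (t + t⁻¹ + 1)) = t ^ 3 + t + t ^ 2 := by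
        push_cast; field_simp; ring
      rw [e]; nlinarith [pow_pos ht0 3, pow_le_pow_left₀ ht0.le ht1 2, pow_le_pow_left₀ ht0.le ht1 3]
    have hperp : t ^ 2 / 4 * (t⁻¹ ^ 2 + 2 * t⁻¹ + 2 * t + t ^ 2 + 6 * (((3 : ℕ) : ℝ) - 2)) ≤ 24 / 25 := by
      have e : t ^ 2 / 4 * (t⁻¹ ^ 2 + 2 * t⁻¹ + 2 * t + t ^ 2 + 6 * (((3 : ℕ) : ℝ) - 2)) =
          1 / 4 + t / 2 + t ^ 3 / 2 + t ^ 4 / 4 + 3 / 2 * t ^ 2 := by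
        push_cast; field_simp; ring
      rw [e]
      nlinarith [pow_pos ht0 3, pow_pos ht0 4, pow_le_pow_left₀ ht0.le ht1 2, pow_le_pow_left₀ ht0.le ht1 3,
        pow_le_pow_left₀ ht0.le ht1 4]
    rw [one_mul]
    rcases le_total (2 * (((3 : ℕ) : ℝ) - 1) * (t + t⁻¹ + 1)) (t⁻¹ ^ 2 + 2 * t⁻¹ + 2 * t + t ^ 2 + 6 * (((3 : ℕ) : ℝ) - 2)) with hle | hle
    · rw [max_eq_right hle]; exact hperp
    · rw [max_eq_left hle]; exact hpar
  have h := ym_abs_cov_le_linfty (d := 3) (N := 2) (by norm_num) (by norm_num) (β := βW / 4) (K := 1) zero_le_one le_rfl hmod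
    ht0 hθ1 (s := 24 / 25) (by norm_num) hsup (μ := μ) (by
      have e : ((2 : ℕ) : ℝ) * (βW / 4) = 2 * (βW / 4) := by norm_num
      rw [e]; exact hμ) hfm hfdep hMf hδf hgm hgdep hMg hδg n hdist
  have e1 : (4 * ((2 : ℕ) : ℝ) / (t * (1 - 24 / 25))) = 200 / t := by
    field_simp; ring
  have e2 : t ^ (2 * n) = βW ^ n := by rw [pow_mul, ht2]
  rw [e1, e2] at h
  exact h

/-- ★ **Every `N ≥ 2`, `d = 4`, hypothesis-free (Bakry–Émery modulus), CLOSED FORM**: at 't Hooft coupling `0 < b ≤ 1/64` (bare `Nb`), with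
`κ = b/(1/2 − 6b)` and `θ = 2√κ`, EVERY DLR state of the `SU(N)` Wilson specification on `ℤ⁴` and ALL bounded measurable local Lipschitz `f, g` with supports at
`ℓ∞`-distance `≥ n` satisfy `|cov_μ(f,g)| ≤ (4N/(θ·(3/100)))(Σδ_g)(Σδ_f) θ^{2n}` — rate `log(1/(4κ))` per lattice unit, `N`-uniform in 't Hooft scaling
(conditions at `√κ ≤ 1/5`: `3√κ + 6κ + 12κ^{3/2} ≤ 0.94`, `1/4 + √κ + 12κ + 4κ^{3/2} + 4κ² ≤ 0.97 = s`). [cite: arXiv220412737, Lemma 4.1] -/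
theorem suN_abs_cov_le_linfty_dim4 (hN : 2 ≤ N) {b : ℝ} (hb0 : 0 < b) (hb : b ≤ 1 / 64)
    {μ : Measure (LGConfig 4 (Matrix.specialUnitaryGroup (Fin N) ℂ))}
    (hμ : μ ∈ ymGibbsMeasures (d := 4) (fundamentalRep (Fin N)) (N * b))
    {f g : LGConfig 4 (Matrix.specialUnitaryGroup (Fin N) ℂ) → ℝ} (hfm : Measurable f) {Δf : Finset (ZdEdge 4)}
    (hfdep : DependsOn f (↑Δf : Set (ZdEdge 4))) {Mf : ℝ} (hMf : ∀ σ, |f σ| ≤ Mf) {δf : ZdEdge 4 → ℝ}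
    (hδf : IsLipBound suFrobDist f δf) (hgm : Measurable g) {Δg : Finset (ZdEdge 4)}
    (hgdep : DependsOn g (↑Δg : Set (ZdEdge 4))) {Mg : ℝ} (hMg : ∀ σ, |g σ| ≤ Mg) {δg : ZdEdge 4 → ℝ}
    (hδg : IsLipBound suFrobDist g δg) (n : ℕ) (hdist : ∀ x ∈ Δf, ∀ y ∈ Δg, (n : ℝ) ≤ ‖x.1 - y.1‖) :
    |cov[f, g; μ]| ≤ 4 * N / (2 * Real.sqrt (b / (1 / 2 - 6 * b)) * (1 - 97 / 100)) * (∑ y ∈ Δg, δg y) * (∑ x ∈ Δf, δf x) *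
      (2 * Real.sqrt (b / (1 / 2 - 6 * b))) ^ (2 * n) := by
  have hN1 : 1 ≤ N := by omega
  have habs : |b| = b := abs_of_pos hb0
  have hlt : |b| * (2 * (((4 : ℕ) : ℝ) - 1)) < 1 / 2 := by rw [habs]; push_cast; nlinarith
  have hmod := Balaban1983to89.StrongCouplingKernelWindow.oneLinkKRModulus_SU hN hlt
  have hden : 0 < 1 / 2 - 6 * b := by linarith
  set κ : ℝ := b / (1 / 2 - 6 * b) with hκ
  have hκ0 : 0 < κ := div_pos hb0 hden
  have hκ26 : κ ≤ 1 / 26 := by rw [hκ, div_le_iff₀ hden]; linarith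
  set t : ℝ := Real.sqrt κ with ht
  have ht0 : 0 < t := Real.sqrt_pos.2 hκ0
  have ht2 : t ^ 2 = κ := Real.sq_sqrt hκ0.le
  have ht5 : t ≤ 1 / 5 := by nlinarith [ht2, ht0]
  have hKb : 1 / (1 / 2 - |b| * (2 * (((4 : ℕ) : ℝ) - 1))) * |b| = t ^ 2 := by
    rw [habs, ht2, hκ]; push_cast; field_simp; ring
  have hθ0 : 0 < 2 * t := by linarith
  have hθ1 : 2 * t ≤ 1 := by linarith
  have htne : t ≠ 0 := ht0.ne'
  have hsup : 1 / (1 / 2 - |b| * (2 * (((4 : ℕ) : ℝ) - 1))) * |b| *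
      max (2 * (((4 : ℕ) : ℝ) - 1) * (2 * t + (2 * t)⁻¹ + 1)) ((2 * t)⁻¹ ^ 2 + 2 * (2 * t)⁻¹ + 2 * (2 * t) + (2 * t) ^ 2 + 6 * (((4 : ℕ) : ℝ) - 2))
        ≤ 97 / 100 := by
    rw [hKb]
    have hpar : t ^ 2 * (2 * (((4 : ℕ) : ℝ) - 1) * (2 * t + (2 * t)⁻¹ + 1)) ≤ 97 / 100 := by
      have e : t ^ 2 * (2 * (((4 : ℕ) : ℝ) - 1) * (2 * t + (2 * t)⁻¹ + 1)) = 3 * t + 6 * t ^ 2 + 12 * t ^ 3 := by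
        push_cast; field_simp; ring
      rw [e]; nlinarith [pow_pos ht0 3, pow_le_pow_left₀ ht0.le ht5 2, pow_le_pow_left₀ ht0.le ht5 3]
    have hperp : t ^ 2 * ((2 * t)⁻¹ ^ 2 + 2 * (2 * t)⁻¹ + 2 * (2 * t) + (2 * t) ^ 2 + 6 * (((4 : ℕ) : ℝ) - 2)) ≤ 97 / 100 := by
      have e : t ^ 2 * ((2 * t)⁻¹ ^ 2 + 2 * (2 * t)⁻¹ + 2 * (2 * t) + (2 * t) ^ 2 + 6 * (((4 : ℕ) : ℝ) - 2)) =
          1 / 4 + t + 12 * t ^ 2 + 4 * t ^ 3 + 4 * t ^ 4 := by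
        push_cast; field_simp; ring
      rw [e]
      nlinarith [pow_pos ht0 3, pow_pos ht0 4, pow_le_pow_left₀ ht0.le ht5 2, pow_le_pow_left₀ ht0.le ht5 3,
        pow_le_pow_left₀ ht0.le ht5 4]
    have ht20 : 0 ≤ t ^ 2 := sq_nonneg _
    rcases le_total (2 * (((4 : ℕ) : ℝ) - 1) * (2 * t + (2 * t)⁻¹ + 1))
        ((2 * t)⁻¹ ^ 2 + 2 * (2 * t)⁻¹ + 2 * (2 * t) + (2 * t) ^ 2 + 6 * (((4 : ℕ) : ℝ) - 2)) with hle | hle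
    · rw [max_eq_right hle]; exact hperp
    · rw [max_eq_left hle]; exact hpar
  have h := ym_abs_cov_le_linfty (d := 4) (N := N) (by norm_num) hN1 (β := b) (K := 1 / (1 / 2 - |b| * (2 * (((4 : ℕ) : ℝ) - 1))))
    (by positivity) le_rfl hmod hθ0 hθ1 (s := 97 / 100) (by norm_num) hsup hμ hfm hfdep hMf hδf hgm hgdep hMg hδg n hdist
  rw [ht] at h
  exact h

end Summit.Ventures.YMGap.RobustBall.ZdAxis

end
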